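import Summits.BirchSwinnertonDyer.BirchSwinnertonDyer.Theses.UniversalToricDescent
import HarnessLib

/-!
# NODE (D-0171) — crux idea `sign-line-tangency` on `RationalSplitIMCInclusionAtThree`
# (stmt-BirchSwinnertonDyer-24207, route UniversalToricDescent, the RATIONAL WALL; crux-ideate standing cover g20, 2026-08-31)

Compiles (`lean check` rc 0, 0 sorry, no banned option). KERNEL theorems
`wallReciprocity_of_conjugateOrthogonality` (P_CO + P_RF + P_SR ⟹ g19's P_ERL `WallReciprocityAtThree 𝓢`) and
`rationalSplitIMCInclusionAtThree_of_signLineTangency` (those three + the LEAD's Euler-side piece P_ES ⟹ the crux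
BY NAME). §A proves the algebra (second-root transfer in a domain; strict-branch vanishing; pointwise dichotomy).
Nothing here proves the crux, the wall, or BSD.

## KEEP/KILL g20 (= g19 table verbatim: no vet / instrument / director line names a 24207 idea since g19's RESULT
## 12:12Z; no «COVER CLOSED 24207»; crux dir has no Disproof.lean / TRIAGE / Negative; negatives BSD = {15532, 24881})
KEEP (LEAD) `Lines/ratwall_thin_comb` v12 (open stub `stub_ratCombDvdUpTo2`, atom K2(b-val)); KEEP g0 eisenstein-kato-swap ·
base-doubling-tau-signs · g2 adic-congruence-ladder (C-g17-1) · g3 · g5 · g6 · g7 · g8 derived-antidiagonal-content-bound ·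
g9 · g10 torsion-anchored-reciprocity · g11 · g12 · g13 · g14 · g15 psi-zero-honda-frame · g16 · g17 · g18 · g19
disc-exact-crystalline-teeth. KILLED (standing): universal-toric-half-order, germ-recentred-tempered-heegner,
tempered-eisenstein, GU(2,1)-as-supply. NEW no-go this gen: B-g20-1 (Kato 2-local-field / Serre–Tate-cusp transplant
carries no anticyclotomic or Rankin–Selberg class: `CH²(F,1)=0`, Manin–Drinfeld) — NOTES/HANDOFF §Barrier notes.

## THE IDEA (technique-differentiated: global duality + complex conjugation as a RECIPROCITY-LAW SUBSTITUTE)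
Every live supply/ERL card (LEAD K2(b-val), g10, g19, g41/g42, g8) must compute a 𝔭-adic dual exponential of a
non-crystalline class at the SUPERCUSPIDAL prime 3. The wall has an unused exact symmetry: `3 = 𝔭𝔭'` and complex
conjugation `c` swaps `𝔭 ↔ 𝔭'` and acts on `Λ_ac` by the involution `ι`. Two consequences, both type-blind:
(Λ) CONJUGATE ORTHOGONALITY — for every `κ ∈ H¹(K, T⊗Λ_ac)`, global reciprocity for `κ ∪ κ^c` gives
    `⟨loc_𝔭 κ, c_* loc_𝔭' κ⟩_{𝔭,Λ} = 0` (sum of local invariants; the two terms at `𝔭`, `𝔭'` are conjugate-equal);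
(μ) SIGN-LINE TANGENCY — at every torsion point `χ` (finite order, sign −1, `Sel_f = ⟨y_χ⟩` by Kolyvagin–Nekovář–YZZ,
    `log_𝔭 y_χ̄ · log_𝔭' y_χ̄ ≠ 0` by Cornut–Vatsal) the image of the 2-dimensional `H¹_(∅,∅)(K,V⊗χ)` in the singular
    quotients `H¹_s(K_𝔭) ⊕ H¹_s(K_𝔭')` IS the line `a·log_𝔭 y_χ̄ + b·log_𝔭' y_χ̄ = 0` (Poitou–Tate against `y_χ̄`;
    `dim H¹_f(K_v, V⊗χ̄) = dim D_dR/Fil⁰ = 1` for de Rham `V` with HT `{0,1}` — no `D_cris` needed). With g15's ψ=0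
    roots (`log_𝔭 y = 𝓛̃^ι·τ`, `log_𝔭' y = 𝓛̃·τ'`, `L = 𝓛̃²·unit`): `exp*_𝔭 κ(χ)·𝓛̃^ι(χ) ≐ −exp*_𝔭' κ(χ)·𝓛̃(χ)`.
So for ANY pair of Λ-adic functionals `(Col_𝔭, Col_𝔭')` interpolating the branch dual exponentials on `μ_{3^∞}`
(bounded ⇒ determined by torsion values): `Col_𝔭(κ)·𝓛̃^ι + Col_𝔭'(κ)·𝓛̃ = 0` — piece P_CO with `𝓢 = Col_𝔭(κ)`,
`𝓢' = Col_𝔭'(κ)`, `𝓡 = 𝓛̃`, `𝓡' = 𝓛̃^ι`. CONSEQUENCES: (a) [B-g20-2, = B-g8-1 re-proved] a Λ_ac-class strict at one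
prime over 3 is 0 (`strictBranch_forces_zero`); (b) DICHOTOMY: at a torsion point a global class is a multiple of
`y_χ` or non-Selmer at BOTH primes with singular ratio `𝓛̃ : −𝓛̃^ι`; (c) SECOND-ROOT TRANSFER (the kernel): the wall
reciprocity law `Col_𝔭(κ) = u·3ᵏ·L` (g19 P_ERL / LEAD K2(b-val)) is EQUIVALENT, given P_CO + P_RF, to the identity at
the OTHER prime `Col_𝔭'(κ) = −u·3ᵏ·𝓛̃·𝓛̃^ι` (geometric mean of the two branch L-functions) — ordinary-sibling check:
Castella 2017 (`κ^{BF}|_ac = 𝓛̃_𝔭·κ^{Hg}`) × Castella–Hsieh (`Log_𝔭' κ^{Hg} = 𝓛̃_𝔭'`) give exactly the geometric mean.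
The unknown 2-vector `(Col_𝔭 κ, Col_𝔭' κ)` collapses to ONE cofactor `𝔠(κ) := Col_𝔭(κ)/𝓛̃`, and the atom becomes the
FIRST-ORDER statement `𝔠(κ) = u·3ᵏ·𝓛̃` («cofactor = root», not `= L`): for sign-line-Selmer classes this is the GLOBAL
statement `κ(χ) ≐ 𝓛̃(χ)·y_χ` (no p-adic Hodge theory at 3 at all); for derived/tooth classes (g8, LEAD) it halves the
reciprocity law and supplies a kit-free VET of every proposed ERL (predicted `𝔭'`-behaviour must be the geometric mean).

## PIECES (tags) — selectors `𝓢, 𝓢', 𝓡, 𝓡' : RegulatorSelector` (g19's type, restated in §B.0; INTENDED `Col_𝔭 κ, Col_𝔭' κ, 𝓛̃, 𝓛̃^ι`)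
* P_ES `EulerSideMemAtThree 𝓢` (g19, = LEAD comb divisibility) — UNDECIDED (LEAD `stub_ratCombDvdUpTo2`); COSTUME iff `𝓢₀ = L`.
* P_CO `ConjugateOrthogonalityAtThree 𝓢 𝓢' 𝓡 𝓡'` — WEAKER than the crux (content: Poitou–Tate + rank one + boundedness;
  ATTACKABLE (M) once Λ-adic branch functionals are typed — leaf L3); vacuous under the antisymmetric costume
  (`conjugateOrthogonality_antisymm`), which is why it is never progress alone.
* P_RF `RootFrameAtThree 𝓡 𝓡'` (`𝓡' ≠ 0`, `L = v·𝓡²`) — WEAKER (g15 (b)/(BDP'): BDP Thm 5.13 + LZZ p-adic Waldspurger,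
  type-blind; INSTRUMENTABLE with g15's P7/P8).
* P_SR `SecondRootIdentityAtThree 𝓢' 𝓡 𝓡'` (`𝓢' = −u·3ᵏ·𝓡·𝓡'`) — UNDECIDED: the transferred atom C⁺ (leaf L4).
KERNEL: P_CO → P_RF → P_SR → `WallReciprocityAtThree 𝓢`; + P_ES → crux (via g19's kernel, restated in §B.0). Faithfulness certificate:
under the antisymmetric costume P_SR is LITERALLY the root form of P_ERL (`secondRoot_antisymm_iff`), so the transfer
loses nothing.

## LEAVES
L1 ATTACKABLE (M, Literature-level): the pointwise tangency law (μ) as a theorem about Selmer structures of a self-dual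
   `V` over `K` with `Sel_f` of rank one (pure Poitou–Tate linear algebra; tree fact `PoitouTateSelmerStructureDualityFact`).
L2 INSTRUMENTABLE (pen-and-paper, acq-15034): ordinary sibling `p ≥ 5`, `p ∤ N`: Castella JLMS 2017 + Castella–Hsieh ⟹
   `Col_𝔭'(κ^{BF}|_ac) = 𝓛̃_𝔭 𝓛̃_𝔭'` (geometric mean) — consistency check of (c); a mismatch kills the card.
L3 IDEA-NEEDED: Λ-adic branch functionals `Col_𝔭, Col_𝔭'` on `H¹(K_𝔭, T⊗Λ_ac)` at the ADDITIVE prime interpolating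
   `exp*` on torsion points (g10 L-g10-1 Colmez de Rham law / g15 Honda frame) — needed to instantiate `𝓢, 𝓢'`.
L4 IDEA-NEEDED / BARRIER (`StringentKolyvaginCapsAtMax`, B-g19-1): who proves «cofactor = root» for a CONSTRUCTED class?
   candidates: g8's derived anti-diagonal class (its 2-variable ERL differentiated), LEAD comb teeth accumulating at
   torsion points (g19 ladder rigidity transfers the identity from teeth to the sign line).
-/

set_option autoImplicit false
set_option linter.dupNamespace false

noncomputable section

open scoped Classical

namespace Summit.BirchSwinnertonDyer.BirchSwinnertonDyer.Cruxes.RationalSplitIMCInclusionAtThree.SignLineTangency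

/-! ## §A  Pure algebra (all proved). -/

section Algebra

variable {S : Type*} [CommRing S]

/-- **A1 (second-root transfer).** In a domain: conjugate orthogonality `Cp·Rc + Cq·R = 0` with `Rc ≠ 0`, the
second-root identity `Cq = −u·q^k·R·Rc` (`u` a unit) and the root frame `L = v·R²` (`v` a unit) give the wall
reciprocity law `w·q^k·L = Cp` with `w` a unit. [cite: Washington1997, §13.4] -/
theorem wall_of_secondRoot [IsDomain S] {Cp Cq R Rc L q : S} (hRc : Rc ≠ 0) (hCO : Cp * Rc + Cq * R = 0)
    (hSR : ∃ (k : ℕ) (u : S), IsUnit u ∧ Cq = -(u * q ^ k * (R * Rc)))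
    (hRF : ∃ v : S, IsUnit v ∧ L = v * R ^ 2) :
    ∃ (k : ℕ) (w : S), IsUnit w ∧ w * q ^ k * L = Cp := by
  obtain ⟨k, u, hu, hq⟩ := hSR
  obtain ⟨v, hv, hL⟩ := hRF
  obtain ⟨v', rfl⟩ := hv
  have h1 : Cp * Rc = (u * q ^ k * R ^ 2) * Rc := by
    rw [hq] at hCO
    linear_combination hCO
  have hCp : Cp = u * q ^ k * R ^ 2 := mul_right_cancel₀ hRc h1
  refine ⟨k, u * ↑v'⁻¹, hu.mul (Units.isUnit v'⁻¹), ?_⟩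
  rw [hL, hCp]
  calc u * ↑v'⁻¹ * q ^ k * (↑v' * R ^ 2) = u * q ^ k * R ^ 2 * (↑v'⁻¹ * ↑v') := by ring
    _ = u * q ^ k * R ^ 2 := by rw [Units.inv_mul, mul_one]

/-- **A2 (strict branch forces zero; typed shadow of B-g20-2(a) = B-g8-1).** If the class is strict at the conjugate
prime (`Cq = 0`) then conjugate orthogonality with `Rc ≠ 0` forces `Cp = 0`: no nonzero Λ_ac-adic branch functional value
survives on a class that is strict at one prime over 3. -/
theorem strictBranch_forces_zero [IsDomain S] {Cp Cq R Rc : S} (hRc : Rc ≠ 0) (hCO : Cp * Rc + Cq * R = 0)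
    (hq : Cq = 0) : Cp = 0 := by
  rw [hq, zero_mul, add_zero] at hCO
  exact (mul_eq_zero.mp hCO).resolve_right hRc

/-- **A3 (pointwise dichotomy at a torsion point).** Over a field: on the tangency line `a·l₁ + b·l₂ = 0` with
`l₁ ≠ 0`, Selmer at the second prime (`b = 0`) forces Selmer at the first (`a = 0`); otherwise the singular ratio is
pinned: `a = −b·l₂/l₁`. -/
theorem dichotomy_of_tangency {F : Type*} [Field F] {a b l₁ l₂ : F} (h : a * l₁ + b * l₂ = 0) (hl₁ : l₁ ≠ 0) :
    (b = 0 → a = 0) ∧ a = -(b * l₂) / l₁ := by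
  constructor
  · intro hb
    rw [hb, zero_mul, add_zero] at h
    exact (mul_eq_zero.mp h).resolve_right hl₁
  · rw [eq_div_iff hl₁]
    linear_combination h

end Algebra

/-! ## §B  Pieces over the crux binders (verbatim telescope), costume certificates. -/

/-! ### §B.0  The g19 frame, restated verbatim (self-contained node: g19's crux workfile is not a built module on the farm).
`RegulatorSelector`, `EulerSideMemAtThree` (P_ES), `WallReciprocityAtThree` (P_ERL) and the g19 kernel are IDENTICAL to
`…Cruxes.RationalSplitIMCInclusionAtThree.DiscExactCrystallineTeeth.*` in `NodeDiscExactCrystallineTeethG19.lean`. -/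

/-- **A4 (g19's reciprocity-transfer door).** `C ∈ I`, `u·q^k·L = C`, `u` a unit ⟹ `q^k·L ∈ I`. -/
theorem pow_mul_mem_of_unit_mul_eq {R : Type*} [CommRing R] {I : Ideal R} {C L u q : R} {k : ℕ}
    (hC : C ∈ I) (hu : IsUnit u) (h : u * q ^ k * L = C) : q ^ k * L ∈ I := by
  obtain ⟨v, rfl⟩ := hu
  have : q ^ k * L = ↑v⁻¹ * C := by
    rw [← h, mul_assoc, ← mul_assoc (↑v⁻¹ : R), Units.inv_mul, one_mul]
  rw [this]
  exact I.mul_mem_left _ hC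

/-- **REGULATOR SELECTOR** (g19): assigns to the row data `(W, K, κ, γ, 𝔭, 𝔭′, L)` one element of `R₀′⟦T⟧`. -/
def RegulatorSelector : Type 1 :=
  ∀ (W : WeierstrassCurve ℚ) (K : Type) [Field K] [NumberField K],
    Literature.NumberTheory.EllipticCurves.ZpExtension K 3 → Field.absoluteGaloisGroup K →
      IsDedekindDomain.HeightOneSpectrum (NumberField.RingOfIntegers K) →
        IsDedekindDomain.HeightOneSpectrum (NumberField.RingOfIntegers K) →
          Literature.NumberTheory.EllipticCurves.UnrSeries 3 → Literature.NumberTheory.EllipticCurves.UnrSeries 3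

/-- **(P_ES) EULER-SYSTEM SIDE** (g19 verbatim) [UNDECIDED — LEAD `stub_ratCombDvdUpTo2`; COSTUME iff `𝓢₀ = L`]: on every
row, `𝓢(row) ∈ Ch_Λ(X_(∅,0))·R₀′⟦T⟧`. -/
def EulerSideMemAtThree (𝓢 : RegulatorSelector) : Prop :=
  ∀ (W : WeierstrassCurve ℚ) [W.IsElliptic] [W.IsGloballyMinimal] (N : ℕ) [NeZero N] (K : Type) [Field K] [NumberField K] (Dt : Literature.NumberTheory.EllipticCurves.ModularForms.ModularParametrizationData W N), Summit.BirchSwinnertonDyer.Rank1Residual.Additive.ClassO6 W 3 → W.HasSurjectiveModNGaloisRep 3 → W.analyticRank = 1 → W.conductorNorm ℤ = N → Literature.NumberTheory.EllipticCurves.IsImaginaryQuadratic K → Literature.NumberTheory.EllipticCurves.SatisfiesHeegnerHypothesis N K → ∀ (κ : Literature.NumberTheory.EllipticCurves.ZpExtension K 3), κ.IsAnticyclotomic → ∀ (γ : Field.absoluteGaloisGroup K) [Fact (κ.IsTopGenerator γ)] (𝔭 : IsDedekindDomain.HeightOneSpectrum (NumberField.RingOfIntegers K)), ((3 : ℕ)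 : NumberField.RingOfIntegers K) ∈ 𝔭.asIdeal → 𝔭.asIdeal.ramificationIdx (NumberField.RingOfIntegers ℚ) = 1 → 𝔭.asIdeal.inertiaDeg (NumberField.RingOfIntegers ℚ) = 1 → ∀ (𝔭' : IsDedekindDomain.HeightOneSpectrum (NumberField.RingOfIntegers K)), ((3 : ℕ) : NumberField.RingOfIntegers K) ∈ 𝔭'.asIdeal → 𝔭' ≠ 𝔭 → ∀ (ι' : PadicAlgCl 3 ≃+* ℂ), Summit.BirchSwinnertonDyer.BirchSwinnertonDyer.Theorems.SchneiderFree.BranchInducesPrime 3 ι' 𝔭 → ∀ (ΩK : ℂ) (Ωp : ℂ_[3]) (L : Literature.NumberTheory.EllipticCurves.UnrSeries 3), ΩK ≠ 0 → Ωp ≠ 0 → Literature.NumberTheory.EllipticCurves.IsBDPLFunction ι' 𝔭 κ γ Dt.f ΩK Ωp L →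
    𝓢 W K κ γ 𝔭 𝔭' L ∈
      (Summit.BirchSwinnertonDyer.Rank1Residual.X11b.AcSelmer.XAc.charIdeal (W.baseChange K) 3 κ 𝔭' ∅ γ).map
        (PowerSeries.map (Summit.BirchSwinnertonDyer.Rank1Residual.X11b.Halves.toUnr 3))

/-- **(P_ERL) WALL RECIPROCITY LAW** (g19 verbatim) [UNDECIDED for the intended selector; this node REDUCES it to P_CO +
P_RF + P_SR]: on every row, `∃ k u, IsUnit u ∧ u·3^k·L = 𝓢(row)`. -/
def WallReciprocityAtThree (𝓢 : RegulatorSelector) : Prop :=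
  ∀ (W : WeierstrassCurve ℚ) [W.IsElliptic] [W.IsGloballyMinimal] (N : ℕ) [NeZero N] (K : Type) [Field K] [NumberField K] (Dt : Literature.NumberTheory.EllipticCurves.ModularForms.ModularParametrizationData W N), Summit.BirchSwinnertonDyer.Rank1Residual.Additive.ClassO6 W 3 → W.HasSurjectiveModNGaloisRep 3 → W.analyticRank = 1 → W.conductorNorm ℤ = N → Literature.NumberTheory.EllipticCurves.IsImaginaryQuadratic K → Literature.NumberTheory.EllipticCurves.SatisfiesHeegnerHypothesis N K → ∀ (κ : Literature.NumberTheory.EllipticCurves.ZpExtension K 3), κ.IsAnticyclotomic → ∀ (γ : Field.absoluteGaloisGroup K) [Fact (κ.IsTopGenerator γ)] (𝔭 : IsDedekindDomain.HeightOneSpectrum (NumberField.RingOfIntegers K)), ((3 : ℕ) : NumberField.RingOfIntegers K) ∈ 𝔭.asIdeal → 𝔭.asIdeal.ramificationIdx (NumberField.RingOfIntegers ℚ) = 1 → 𝔭.asIdeal.inertiaDeg (NumberField.RingOfIntegers ℚ) = 1 → ∀ (𝔭' : IsDedekindDomain.HeightOneSpectrum (NumberField.RingOfIntegers K)), ((3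 : ℕ) : NumberField.RingOfIntegers K) ∈ 𝔭'.asIdeal → 𝔭' ≠ 𝔭 → ∀ (ι' : PadicAlgCl 3 ≃+* ℂ), Summit.BirchSwinnertonDyer.BirchSwinnertonDyer.Theorems.SchneiderFree.BranchInducesPrime 3 ι' 𝔭 → ∀ (ΩK : ℂ) (Ωp : ℂ_[3]) (L : Literature.NumberTheory.EllipticCurves.UnrSeries 3), ΩK ≠ 0 → Ωp ≠ 0 → Literature.NumberTheory.EllipticCurves.IsBDPLFunction ι' 𝔭 κ γ Dt.f ΩK Ωp L →
    ∃ (k : ℕ) (u : Literature.NumberTheory.EllipticCurves.UnrSeries 3), IsUnit u ∧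
      u * ((3 : ℕ) : Literature.NumberTheory.EllipticCurves.UnrSeries 3) ^ k * L = 𝓢 W K κ γ 𝔭 𝔭' L

/-- **g19 KERNEL (verbatim).** P_ES + P_ERL ⟹ crux 24207 BY NAME, for any selector. -/
theorem rationalSplitIMCInclusionAtThree_of_wallReciprocity (𝓢 : RegulatorSelector)
    (hES : EulerSideMemAtThree 𝓢) (hERL : WallReciprocityAtThree 𝓢) :
    Summit.BirchSwinnertonDyer.BirchSwinnertonDyer.Theses.UniversalToricDescent.RationalSplitIMCInclusionAtThree := by
  intro W _ _ N _ K _ _ Dt hO6 hsurj hr1 hN hK hH κ hκ γ _ 𝔭 h𝔭 he hf 𝔭' h𝔭' hne ι' hι ΩK Ωp L hΩK hΩp hL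
  have hC := hES W N K Dt hO6 hsurj hr1 hN hK hH κ hκ γ 𝔭 h𝔭 he hf 𝔭' h𝔭' hne ι' hι ΩK Ωp L hΩK hΩp hL
  obtain ⟨k, u, hu, h⟩ := hERL W N K Dt hO6 hsurj hr1 hN hK hH κ hκ γ 𝔭 h𝔭 he hf 𝔭' h𝔭' hne ι' hι ΩK Ωp L hΩK hΩp hL
  exact ⟨k, pow_mul_mem_of_unit_mul_eq hC hu h⟩

/-! ### §B.1  This node's pieces. -/

/-- A predicate on the row data the selectors see: `(W, K, κ, γ, 𝔭, 𝔭', L)`. -/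
def RowPredicate : Type 1 :=
  ∀ (W : WeierstrassCurve ℚ) (K : Type) [Field K] [NumberField K],
    Literature.NumberTheory.EllipticCurves.ZpExtension K 3 → Field.absoluteGaloisGroup K →
      IsDedekindDomain.HeightOneSpectrum (NumberField.RingOfIntegers K) →
        IsDedekindDomain.HeightOneSpectrum (NumberField.RingOfIntegers K) →
          Literature.NumberTheory.EllipticCurves.UnrSeries 3 → Prop

/-- `P` holds ON EVERY ROW of the crux (the binder telescope of `RationalSplitIMCInclusionAtThree`, verbatim). -/
def OnEveryRow (P : RowPredicate) : Prop :=
  ∀ (W : WeierstrassCurve ℚ) [W.IsElliptic] [W.IsGloballyMinimal] (N : ℕ) [NeZero N] (K : Type) [Field K] [NumberField K] (Dt : Literature.NumberTheory.EllipticCurves.ModularForms.ModularParametrizationData W N), Summit.BirchSwinnertonDyer.Rank1Residual.Additive.ClassO6 W 3 → W.HasSurjectiveModNGaloisRep 3 → W.analyticRank = 1 → W.conductorNorm ℤ = N → Literature.NumberTheory.EllipticCurves.IsImaginaryQuadratic K → Literature.NumberTheory.EllipticCurves.SatisfiesHeegnerHypothesis N K → ∀ (κ : Literature.NumberTheory.EllipticCurves.ZpExtension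 K 3), κ.IsAnticyclotomic → ∀ (γ : Field.absoluteGaloisGroup K) [Fact (κ.IsTopGenerator γ)] (𝔭 : IsDedekindDomain.HeightOneSpectrum (NumberField.RingOfIntegers K)), ((3 : ℕ) : NumberField.RingOfIntegers K) ∈ 𝔭.asIdeal → 𝔭.asIdeal.ramificationIdx (NumberField.RingOfIntegers ℚ) = 1 → 𝔭.asIdeal.inertiaDeg (NumberField.RingOfIntegers ℚ) = 1 → ∀ (𝔭' : IsDedekindDomain.HeightOneSpectrum (NumberField.RingOfIntegers K)), ((3 : ℕ) : NumberField.RingOfIntegers K) ∈ 𝔭'.asIdeal → 𝔭' ≠ 𝔭 → ∀ (ι' : PadicAlgCl 3 ≃+* ℂ), Summit.BirchSwinnertonDyer.BirchSwinnertonDyer.Theorems.SchneiderFree.BranchInducesPrime 3 ι' 𝔭 → ∀ (ΩK : ℂ) (Ωp : ℂ_[3]) (L : Literature.NumberTheory.EllipticCurves.UnrSeries 3), ΩK ≠ 0 → Ωp ≠ 0 → Literature.NumberTheory.EllipticCurves.IsBDPLFunction ι' 𝔭 κ γ Dt.f ΩK Ωp L →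
    P W K κ γ 𝔭 𝔭' L

/-- Monotonicity of `OnEveryRow` (rowwise implication). -/
theorem onEveryRow_mono {P Q : RowPredicate}
    (h : ∀ (W : WeierstrassCurve ℚ) (K : Type) [Field K] [NumberField K]
      (κ : Literature.NumberTheory.EllipticCurves.ZpExtension K 3) (γ : Field.absoluteGaloisGroup K)
      (𝔭 𝔭' : IsDedekindDomain.HeightOneSpectrum (NumberField.RingOfIntegers K))
      (L : Literature.NumberTheory.EllipticCurves.UnrSeries 3), P W K κ γ 𝔭 𝔭' L → Q W K κ γ 𝔭 𝔭' L)
    (hP : OnEveryRow P) : OnEveryRow Q := by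
  intro W _ _ N _ K _ _ Dt hO6 hsurj hr1 hN hK hH κ hκ γ _ 𝔭 h𝔭 he hf 𝔭' h𝔭' hne ι' hι ΩK Ωp L hΩK hΩp hL
  exact h W K κ γ 𝔭 𝔭' L (hP W N K Dt hO6 hsurj hr1 hN hK hH κ hκ γ 𝔭 h𝔭 he hf 𝔭' h𝔭' hne ι' hι ΩK Ωp L hΩK hΩp hL)

/-- Conjunction of two rowwise pieces. -/
theorem onEveryRow_and {P Q : RowPredicate} (hP : OnEveryRow P) (hQ : OnEveryRow Q) :
    OnEveryRow (fun W K _ _ κ γ 𝔭 𝔭' L => P W K κ γ 𝔭 𝔭' L ∧ Q W K κ γ 𝔭 𝔭' L) := by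
  intro W _ _ N _ K _ _ Dt hO6 hsurj hr1 hN hK hH κ hκ γ _ 𝔭 h𝔭 he hf 𝔭' h𝔭' hne ι' hι ΩK Ωp L hΩK hΩp hL
  exact ⟨hP W N K Dt hO6 hsurj hr1 hN hK hH κ hκ γ 𝔭 h𝔭 he hf 𝔭' h𝔭' hne ι' hι ΩK Ωp L hΩK hΩp hL,
    hQ W N K Dt hO6 hsurj hr1 hN hK hH κ hκ γ 𝔭 h𝔭 he hf 𝔭' h𝔭' hne ι' hι ΩK Ωp L hΩK hΩp hL⟩

/-- **(P_CO) CONJUGATE ORTHOGONALITY** [WEAKER · ATTACKABLE once L3 types the branch functionals; vacuous under the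
antisymmetric costume]: on every row `𝓢·𝓡' + 𝓢'·𝓡 = 0` — INTENDED `Col_𝔭(κ)·𝓛̃^ι + Col_𝔭'(κ)·𝓛̃ = 0`
(Poitou–Tate for `κ ∪ κ^c` + sign-line rank one + boundedness). -/
def ConjugateOrthogonalityAtThree (𝓢 𝓢' 𝓡 𝓡' : RegulatorSelector) : Prop :=
  OnEveryRow fun W K _ _ κ γ 𝔭 𝔭' L => 𝓢 W K κ γ 𝔭 𝔭' L * 𝓡' W K κ γ 𝔭 𝔭' L + 𝓢' W K κ γ 𝔭 𝔭' L * 𝓡 W K κ γ 𝔭 𝔭' L = 0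

/-- **(P_RF) ROOT FRAME** [WEAKER · INSTRUMENTABLE; g15 (b)/(BDP'), BDP Thm 5.13 + LZZ]: on every row the conjugate root is
nonzero and `L = v·𝓡²` with `v` a unit — INTENDED `𝓡 = 𝓛̃` (ψ=0 Heegner root), `𝓡' = 𝓛̃^ι`. -/
def RootFrameAtThree (𝓡 𝓡' : RegulatorSelector) : Prop :=
  OnEveryRow fun W K _ _ κ γ 𝔭 𝔭' L => 𝓡' W K κ γ 𝔭 𝔭' L ≠ 0 ∧
    ∃ v : Literature.NumberTheory.EllipticCurves.UnrSeries 3, IsUnit v ∧ L = v * 𝓡 W K κ γ 𝔭 𝔭' L ^ 2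

/-- **(P_SR) SECOND-ROOT IDENTITY at the conjugate prime** [UNDECIDED — the transferred atom C⁺, leaf L4]: on every row
`𝓢' = −u·3ᵏ·𝓡·𝓡'` — INTENDED `Col_𝔭'(κ) = −u·3ᵏ·𝓛̃·𝓛̃^ι` (geometric mean of the two branch L-functions). -/
def SecondRootIdentityAtThree (𝓢' 𝓡 𝓡' : RegulatorSelector) : Prop :=
  OnEveryRow fun W K _ _ κ γ 𝔭 𝔭' L => ∃ (k : ℕ) (u : Literature.NumberTheory.EllipticCurves.UnrSeries 3), IsUnit u ∧
    𝓢' W K κ γ 𝔭 𝔭' L = -(u * ((3 : ℕ) : Literature.NumberTheory.EllipticCurves.UnrSeries 3) ^ k *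
      (𝓡 W K κ γ 𝔭 𝔭' L * 𝓡' W K κ γ 𝔭 𝔭' L))

/-- The ANTISYMMETRIC (c-symmetric) costume: `𝓢' := −𝓢`. -/
def antisymm (𝓢 : RegulatorSelector) : RegulatorSelector := fun W K _ _ κ γ 𝔭 𝔭' L => -(𝓢 W K κ γ 𝔭 𝔭' L)

/-- COSTUME certificate 1/2: with `𝓢' = −𝓢` and `𝓡' = 𝓡` conjugate orthogonality is VACUOUS (so P_CO alone is never
progress; its content lives in the INTENDED selectors of leaf L3). -/
theorem conjugateOrthogonality_antisymm (𝓢 𝓡 : RegulatorSelector) :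
    ConjugateOrthogonalityAtThree 𝓢 (antisymm 𝓢) 𝓡 𝓡 := by
  intro W _ _ N _ K _ _ Dt _ _ _ _ _ _ κ _ γ _ 𝔭 _ _ _ 𝔭' _ _ ι' _ ΩK Ωp L _ _ _
  simp only [antisymm]
  ring

/-- COSTUME certificate 2/2 (faithfulness of the transfer): under the same costume the second-root identity is
LITERALLY the root form `𝓢 = u·3ᵏ·𝓡²` of the wall reciprocity law — the transfer to the conjugate prime loses nothing. -/
theorem secondRoot_antisymm_iff (𝓢 𝓡 : RegulatorSelector) :
    SecondRootIdentityAtThree (antisymm 𝓢) 𝓡 𝓡 ↔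
      OnEveryRow fun W K _ _ κ γ 𝔭 𝔭' L => ∃ (k : ℕ) (u : Literature.NumberTheory.EllipticCurves.UnrSeries 3),
        IsUnit u ∧ 𝓢 W K κ γ 𝔭 𝔭' L = u * ((3 : ℕ) : Literature.NumberTheory.EllipticCurves.UnrSeries 3) ^ k *
          𝓡 W K κ γ 𝔭 𝔭' L ^ 2 := by
  constructor <;> refine fun h => onEveryRow_mono (fun W K _ _ κ γ 𝔭 𝔭' L hrow => ?_) h
  · obtain ⟨k, u, hu, h⟩ := hrow
    refine ⟨k, u, hu, ?_⟩
    simp only [antisymm, neg_inj] at h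
    rw [h]; ring
  · obtain ⟨k, u, hu, h⟩ := hrow
    refine ⟨k, u, hu, ?_⟩
    simp only [antisymm, neg_inj]
    rw [h]; ring

/-! ## §C  Kernel theorems (no sorry): the pieces conclude g19's P_ERL, hence the crux BY NAME. -/

/-- **KERNEL 1 (second-root transfer on the wall).** Conjugate orthogonality + root frame + the second-root identity at the
conjugate prime ⟹ the wall reciprocity law at the crux's prime, for ANY selectors. -/
theorem wallReciprocity_of_conjugateOrthogonality (𝓢 𝓢' 𝓡 𝓡' : RegulatorSelector)
    (hCO : ConjugateOrthogonalityAtThree 𝓢 𝓢' 𝓡 𝓡') (hRF : RootFrameAtThree 𝓡 𝓡')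
    (hSR : SecondRootIdentityAtThree 𝓢' 𝓡 𝓡') : WallReciprocityAtThree 𝓢 := by
  intro W _ _ N _ K _ _ Dt hO6 hsurj hr1 hN hK hH κ hκ γ _ 𝔭 h𝔭 he hf 𝔭' h𝔭' hne ι' hι ΩK Ωp L hΩK hΩp hL
  have h1 := hCO W N K Dt hO6 hsurj hr1 hN hK hH κ hκ γ 𝔭 h𝔭 he hf 𝔭' h𝔭' hne ι' hι ΩK Ωp L hΩK hΩp hL
  obtain ⟨h2, h3⟩ := hRF W N K Dt hO6 hsurj hr1 hN hK hH κ hκ γ 𝔭 h𝔭 he hf 𝔭' h𝔭' hne ι' hι ΩK Ωp L hΩK hΩp hL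
  have h4 := hSR W N K Dt hO6 hsurj hr1 hN hK hH κ hκ γ 𝔭 h𝔭 he hf 𝔭' h𝔭' hne ι' hι ΩK Ωp L hΩK hΩp hL
  exact wall_of_secondRoot h2 h1 h4 h3

/-- **KERNEL 2 (concludes the crux BY NAME).** LEAD Euler-side membership (P_ES) + P_CO + P_RF + P_SR ⟹ crux 24207. -/
theorem rationalSplitIMCInclusionAtThree_of_signLineTangency (𝓢 𝓢' 𝓡 𝓡' : RegulatorSelector)
    (hES : EulerSideMemAtThree 𝓢) (hCO : ConjugateOrthogonalityAtThree 𝓢 𝓢' 𝓡 𝓡')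
    (hRF : RootFrameAtThree 𝓡 𝓡') (hSR : SecondRootIdentityAtThree 𝓢' 𝓡 𝓡') :
    Summit.BirchSwinnertonDyer.BirchSwinnertonDyer.Theses.UniversalToricDescent.RationalSplitIMCInclusionAtThree :=
  rationalSplitIMCInclusionAtThree_of_wallReciprocity 𝓢 hES
    (wallReciprocity_of_conjugateOrthogonality 𝓢 𝓢' 𝓡 𝓡' hCO hRF hSR)

/-- **KERNEL 2′ (halving, the other direction).** Conversely, the wall reciprocity law at `𝔭` + conjugate orthogonality +
root frame with `𝓡 ≠ 0` ⟹ the second-root identity at `𝔭'`: given P_CO + P_RF the two branch laws are EQUIVALENT, so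
either prime may be attacked. -/
theorem secondRoot_of_wallReciprocity (𝓢 𝓢' 𝓡 𝓡' : RegulatorSelector)
    (hERL : WallReciprocityAtThree 𝓢) (hCO : ConjugateOrthogonalityAtThree 𝓢 𝓢' 𝓡 𝓡') (hRF : RootFrameAtThree 𝓡 𝓡')
    (hR : OnEveryRow fun W K _ _ κ γ 𝔭 𝔭' L => 𝓡 W K κ γ 𝔭 𝔭' L ≠ 0) :
    SecondRootIdentityAtThree 𝓢' 𝓡 𝓡' := by
  intro W _ _ N _ K _ _ Dt hO6 hsurj hr1 hN hK hH κ hκ γ _ 𝔭 h𝔭 he hf 𝔭' h𝔭' hne ι' hι ΩK Ωp L hΩK hΩp hL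
  obtain ⟨k, u, hu, h0⟩ := hERL W N K Dt hO6 hsurj hr1 hN hK hH κ hκ γ 𝔭 h𝔭 he hf 𝔭' h𝔭' hne ι' hι ΩK Ωp L hΩK hΩp hL
  have h1 := hCO W N K Dt hO6 hsurj hr1 hN hK hH κ hκ γ 𝔭 h𝔭 he hf 𝔭' h𝔭' hne ι' hι ΩK Ωp L hΩK hΩp hL
  obtain ⟨-, v, hv, hLv⟩ := hRF W N K Dt hO6 hsurj hr1 hN hK hH κ hκ γ 𝔭 h𝔭 he hf 𝔭' h𝔭' hne ι' hι ΩK Ωp L hΩK hΩp hL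
  have h2 := hR W N K Dt hO6 hsurj hr1 hN hK hH κ hκ γ 𝔭 h𝔭 he hf 𝔭' h𝔭' hne ι' hι ΩK Ωp L hΩK hΩp hL
  -- abbreviate the row values
  set Cp := 𝓢 W K κ γ 𝔭 𝔭' L
  set Cq := 𝓢' W K κ γ 𝔭 𝔭' L
  set R := 𝓡 W K κ γ 𝔭 𝔭' L
  set Rc := 𝓡' W K κ γ 𝔭 𝔭' L
  refine ⟨k, u * v, hu.mul hv, ?_⟩
  -- from `Cp·Rc + Cq·R = 0`, `Cp = u·3^k·L`, `L = v·R²`: `Cq·R = -(u·v·3^k·R·Rc)·R`, cancel `R ≠ 0`.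
  have h3 : Cq * R = -(u * v * ((3 : ℕ) : Literature.NumberTheory.EllipticCurves.UnrSeries 3) ^ k * (R * Rc)) * R := by
    have : Cq * R = -(Cp * Rc) := by linear_combination h1
    rw [this, ← h0, hLv]; ring
  exact mul_right_cancel₀ h2 h3

end Summit.BirchSwinnertonDyer.BirchSwinnertonDyer.Cruxes.RationalSplitIMCInclusionAtThree.SignLineTangency

end
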